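import Summits.CriticalPhenomena.PercolationContinuityZ3.Theorems.PercNearOneGluingNoHeavyLowerTailKnQuestion8AntitheticTwin
import HarnessLib

/-!
# `NoHeavyLowerTail` (crux stmt-CriticalPhenomena-4575), antithetic vdBHK programme: TWIN ATOMS II — the cross relations of the twin bundle `Ω_{Q + d′}`
# and the TWIN TRANSFER inequality

Support file (seat `prim-ineq-gen-7` gen 56; `--supports stmt-CriticalPhenomena-4575`).  No `sorry`, no definitions.  Second half of the twin dictionary
(first half: `AntitheticTwin` — diagonal and antidiagonal of the twin bundle); same hypothesis-style SETTING (ground set `E` of a poset `Q`, strict down-sets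
`down`, atom `u`, `dead e ↔ e ∈ ↑°u`, twin atom `z = none` with `↓°z = ∅`, explicit colouring orders `leZ` of `Q + z`; `true` = red).
Memo: run/shared/lean/prim/prim-ineq-gen-7/FINDING-TWIN-g56.md §1–2.
* `AntitheticTwinTransfer.cross_iff_twin`, `cross_iff_twin'` — the relations diagonal → antidiagonal (`00 → 01`, `00 → 10`) and antidiagonal → diagonal
  (`01 → 11`, `10 → 11`) of `Ω_{Q+z}` are exactly the dead order `M = Ω_{Q∖↑u} × (blue<red)^{↑°u}` on the restrictions, and no relation leaves the fibre `11`
  or enters the fibre `00`.  With `AntitheticTwin.diag_iff_twin` / `off_iff_twin`: `Ω_{Q+z}` is the BUNDLE over the square `00 < 01, 10 < 11` with fibres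
  `L = Ω_Q ∩ {u red}`, `M`, `M`, `P = Ω_Q ∩ {u blue}`, all four side orders `= M`, long diagonal `00 → 11` = the cross order of `Ω_Q`, and `01 ∥ 10`
  (TWIN STRUCTURE THEOREM, memo §1; machine-exact on all 226 rooted posets with `≤ 5` elements).
* `AntitheticTwinTransfer.transfer_bound` — `⟨1_V − 1_{V′}, 1_X − 1_{X′}⟩ ≥ −#((V∖V′) ∩ (X′∖X)) − #((V′∖V) ∩ (X∖X′))` for arbitrary finite sets.
* `AntitheticTwinTransfer.twin_transfer` — TWIN TRANSFER (memo §2): writing an up-set of `Ω_{Q+z}` as its fibre traces `(A₀, V, V′, A₁)` (`(A₀,A₁)` an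
  up-set of `Ω_Q`, `V, V′` up-sets of `M`, `A₀ ⊆ V, V′ ⊆ A₁`), the antipodal-Kleitman sum of `Ω_{Q+z}` at two up-sets equals
  `AK_{Ω_Q}((A₀,A₁),(B₀,B₁)) + AK_M(V,W) + AK_M(V′,W′) + ⟨1_V − 1_{V′}, (1_W − 1_{W′}) ∘ j⟩` (`j` = colour swap); so AK of `M` (product theorem + descent)
  and the TWIN SLACK INEQUALITY `TSI(Q,u)`: `AK_{Ω_Q}(A,B) + ⟨1_V − 1_{V′}, (1_W − 1_{W′}) ∘ j⟩ ≥ 0` for all admissible middles — equivalently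
  `AK_{Ω_Q}(A,B) ≥ #(D_A ∩ j D_B)`, `D_A = int_M(A₁) ∖ ↑_M(A₀)` — give AK of the twin poset `Ω_{Q+z}`.  CENSUS (memo §3): `TSI(Q,u)` holds with minimum
  exactly `0` for all 45 rooted posets with `≤ 4` elements and for every rooted `5`-element poset except the W-fence at its middle atom — the same single
  exception as the rearrangement inequality `(R)` (FINDING-FENCE-g51); there the twin poset is AK nevertheless (the `AK_M` slack is needed).
-/

namespace Summit.CriticalPhenomena.PercolationContinuityZ3.Theorems

open Finset

namespace AntitheticTwinTransfer

variable {E : Type*}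



/-- **TWIN CROSS RELATIONS (diagonal → antidiagonal).**  With `z ≡ u` in `t` and `z ≢ u` in `t′`, `leZ t t′` holds iff `u` is RED in `t` (fibre `00`; no
relation leaves the fibre `11`), the three conditions hold at every live element for the restrictions, and every dead element red in `t` is red in `t′`:
the side orders `00 → 01` and `00 → 10` of the twin bundle are the dead order `M`. [this work] -/
theorem cross_iff_twin (down : E → Finset E) (u : E) (hu : ∀ d, d ∉ down u) (dead : E → Prop) (hdu : ∀ e, dead e → u ∈ down e)
    (downZ : Option E → Finset (Option E)) (hdZn : ∀ o, o ∉ downZ none)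
    (hdZs : ∀ e o, o ∈ downZ (some e) ↔ (∃ d ∈ down e, o = some d) ∨ (o = none ∧ dead e))
    (leZ : (Option E → Bool) → (Option E → Bool) → Prop)
    (hleZ : ∀ s t, leZ s t ↔
      ((∀ o, (t o = true ∧ ∀ d ∈ downZ o, t d = true) → (s o = true ∧ ∀ d ∈ downZ o, s d = true)) ∧
       (∀ o, (s o = false ∧ ∀ d ∈ downZ o, s d = false) → (t o = false ∧ ∀ d ∈ downZ o, t d = false)) ∧
       (∀ o, s o = true → t o = false → ((∀ d ∈ downZ o, s d = true) ∧ (∀ d ∈ downZ o, t d = false)))))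
    (s s' : E → Bool) (t t' : Option E → Bool) (hts : ∀ e, t (some e) = s e) (hts' : ∀ e, t' (some e) = s' e)
    (htn : t none = s u) (htn' : t' none = !(s' u)) :
    leZ t t' ↔
      (s u = true ∧
       ((∀ e, ¬ dead e → (s' e = true ∧ ∀ d ∈ down e, s' d = true) → (s e = true ∧ ∀ d ∈ down e, s d = true)) ∧
        (∀ e, ¬ dead e → (s e = false ∧ ∀ d ∈ down e, s d = false) → (s' e = false ∧ ∀ d ∈ down e, s' d = false)) ∧
        (∀ e, ¬ dead e → s e = true → s' e = false → ((∀ d ∈ down e, s d = true) ∧ (∀ d ∈ down e, s' d = false)))) ∧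
       (∀ e, dead e → s e = true → s' e = true)) := by
  have vac : ∀ (r : E → Bool) (b : Bool), (∀ d ∈ down u, r d = b) := fun r b d hd => (hu d hd).elim
  have hnu : ¬ dead u := fun h => hu u (hdu u h)
  have HS := AntitheticInsertion.forall_downZ_some_ins down dead downZ hdZs
  have HN := AntitheticTwin.forall_downZ_none_twin downZ hdZn
  have live : ∀ (r : E → Bool) (rz : Option E → Bool) (b : Bool),
      ∀ e, ¬ dead e → (((∀ d ∈ down e, r d = b) ∧ (dead e → rz none = b)) ↔ (∀ d ∈ down e, r d = b)) := by
    intro r rz b e he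
    constructor
    · rintro ⟨h1, -⟩; exact h1
    · intro h; exact ⟨h, fun he' => (he he').elim⟩
  -- in `t′` a dead down-set is never monochromatic; in `t` the extra member is `z ≡ u`
  have nomono' : ∀ (b : Bool) (e : E), dead e → ¬ ((∀ d ∈ down e, t' (some d) = b) ∧ (dead e → t' none = b)) := by
    intro b e he ⟨h1, h2⟩
    have a1 := h1 u (hdu e he); rw [hts'] at a1
    have a2 := h2 he; rw [htn', a1] at a2
    cases b <;> simp at a2
  rw [hleZ]
  constructor
  · rintro ⟨h1, h2, h3⟩
    have L1 : ∀ e, ¬ dead e → (s' e = true ∧ ∀ d ∈ down e, s' d = true) → (s e = true ∧ ∀ d ∈ down e, s d = true) := by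
      intro e he
      have h := h1 (some e)
      simp only [HS, live s t true e he, live s' t' true e he, hts, hts'] at h; exact h
    have L2 : ∀ e, ¬ dead e → (s e = false ∧ ∀ d ∈ down e, s d = false) → (s' e = false ∧ ∀ d ∈ down e, s' d = false) := by
      intro e he
      have h := h2 (some e)
      simp only [HS, live s t false e he, live s' t' false e he, hts, hts'] at h; exact h
    have hsu : s u = true := by
      -- if `u` were blue in `t`, condition 2 at `z` would make `z` blue in `t′`, i.e. `u` red in `t′`: an atom cannot turn blue → red
      cases hsu' : s u with
      | true => rfl
      | false =>
        have hn := h2 none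
        simp only [HN, htn, htn', and_true] at hn
        have hz : (!(s' u)) = false := hn hsu'
        have hs'u : s' u = true := by
          cases h' : s' u with
          | true => rfl
          | false => rw [h'] at hz; exact absurd hz (by decide)
        have h0 := (L1 u hnu ⟨hs'u, vac s' true⟩).1
        rw [hsu'] at h0; exact absurd h0 (by decide)
    refine ⟨hsu, ⟨L1, L2, fun e he => ?_⟩, fun e he hse => ?_⟩
    · have h := h3 (some e)
      simp only [HS, live s t true e he, live s' t' false e he, hts, hts'] at h; exact h
    · by_contra hne
      have hs'e : s' e = false := by
        cases h' : s' e with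
        | false => rfl
        | true => exact absurd h' hne
      have h := h3 (some e)
      rw [hts, hts'] at h
      have hh := (h hse hs'e).2
      rw [HS] at hh
      exact nomono' false e he hh
  · rintro ⟨hsu, ⟨h1, h2, h3⟩, hd⟩
    refine ⟨fun o => ?_, fun o => ?_, fun o => ?_⟩
    · cases o with
      | none =>
        simp only [HN, htn, htn', and_true]
        intro _; exact hsu
      | some e =>
        by_cases he : dead e
        · rintro ⟨-, hb⟩; rw [HS] at hb; exact (nomono' true e he hb).elim
        · simp only [HS, live s t true e he, live s' t' true e he, hts, hts']; exact h1 e he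
    · cases o with
      | none =>
        simp only [HN, htn, htn', and_true]
        intro ha; rw [hsu] at ha; exact absurd ha (by decide)
      | some e =>
        by_cases he : dead e
        · rintro ⟨-, hb⟩
          rw [HS] at hb
          have h0 := hb.1 u (hdu e he); rw [hts, hsu] at h0; exact absurd h0 (by decide)
        · simp only [HS, live s t false e he, live s' t' false e he, hts, hts']; exact h2 e he
    · cases o with
      | none =>
        simp only [HN, htn, htn', and_self]
        intro _ _; trivial
      | some e =>
        by_cases he : dead e
        · intro ha hb
          rw [hts] at ha; rw [hts'] at hb
          have h0 := hd e he ha; rw [h0] at hb; exact absurd hb (by decide)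
        · simp only [HS, live s t true e he, live s' t' false e he, hts, hts']; exact h3 e he

/-- **TWIN CROSS RELATIONS (antidiagonal → diagonal).**  With `z ≢ u` in `t` and `z ≡ u` in `t′`, `leZ t t′` holds iff `u` is BLUE in `t′` (fibre `11`; no
relation enters the fibre `00`), the three conditions hold at every live element, and every dead element red in `t` is red in `t′`: the side orders
`01 → 11` and `10 → 11` are the dead order `M`. [this work] -/
theorem cross_iff_twin' (down : E → Finset E) (u : E) (hu : ∀ d, d ∉ down u) (dead : E → Prop) (hdu : ∀ e, dead e → u ∈ down e)
    (downZ : Option E → Finset (Option E)) (hdZn : ∀ o, o ∉ downZ none)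
    (hdZs : ∀ e o, o ∈ downZ (some e) ↔ (∃ d ∈ down e, o = some d) ∨ (o = none ∧ dead e))
    (leZ : (Option E → Bool) → (Option E → Bool) → Prop)
    (hleZ : ∀ s t, leZ s t ↔
      ((∀ o, (t o = true ∧ ∀ d ∈ downZ o, t d = true) → (s o = true ∧ ∀ d ∈ downZ o, s d = true)) ∧
       (∀ o, (s o = false ∧ ∀ d ∈ downZ o, s d = false) → (t o = false ∧ ∀ d ∈ downZ o, t d = false)) ∧
       (∀ o, s o = true → t o = false → ((∀ d ∈ downZ o, s d = true) ∧ (∀ d ∈ downZ o, t d = false)))))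
    (s s' : E → Bool) (t t' : Option E → Bool) (hts : ∀ e, t (some e) = s e) (hts' : ∀ e, t' (some e) = s' e)
    (htn : t none = !(s u)) (htn' : t' none = s' u) :
    leZ t t' ↔
      (s' u = false ∧
       ((∀ e, ¬ dead e → (s' e = true ∧ ∀ d ∈ down e, s' d = true) → (s e = true ∧ ∀ d ∈ down e, s d = true)) ∧
        (∀ e, ¬ dead e → (s e = false ∧ ∀ d ∈ down e, s d = false) → (s' e = false ∧ ∀ d ∈ down e, s' d = false)) ∧
        (∀ e, ¬ dead e → s e = true → s' e = false → ((∀ d ∈ down e, s d = true) ∧ (∀ d ∈ down e, s' d = false)))) ∧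
       (∀ e, dead e → s e = true → s' e = true)) := by
  have vac : ∀ (r : E → Bool) (b : Bool), (∀ d ∈ down u, r d = b) := fun r b d hd => (hu d hd).elim
  have hnu : ¬ dead u := fun h => hu u (hdu u h)
  have HS := AntitheticInsertion.forall_downZ_some_ins down dead downZ hdZs
  have HN := AntitheticTwin.forall_downZ_none_twin downZ hdZn
  have live : ∀ (r : E → Bool) (rz : Option E → Bool) (b : Bool),
      ∀ e, ¬ dead e → (((∀ d ∈ down e, r d = b) ∧ (dead e → rz none = b)) ↔ (∀ d ∈ down e, r d = b)) := by
    intro r rz b e he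
    constructor
    · rintro ⟨h1, -⟩; exact h1
    · intro h; exact ⟨h, fun he' => (he he').elim⟩
  have nomono : ∀ (b : Bool) (e : E), dead e → ¬ ((∀ d ∈ down e, t (some d) = b) ∧ (dead e → t none = b)) := by
    intro b e he ⟨h1, h2⟩
    have a1 := h1 u (hdu e he); rw [hts] at a1
    have a2 := h2 he; rw [htn, a1] at a2
    cases b <;> simp at a2
  rw [hleZ]
  constructor
  · rintro ⟨h1, h2, h3⟩
    have L1 : ∀ e, ¬ dead e → (s' e = true ∧ ∀ d ∈ down e, s' d = true) → (s e = true ∧ ∀ d ∈ down e, s d = true) := by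
      intro e he
      have h := h1 (some e)
      simp only [HS, live s t true e he, live s' t' true e he, hts, hts'] at h; exact h
    have L2 : ∀ e, ¬ dead e → (s e = false ∧ ∀ d ∈ down e, s d = false) → (s' e = false ∧ ∀ d ∈ down e, s' d = false) := by
      intro e he
      have h := h2 (some e)
      simp only [HS, live s t false e he, live s' t' false e he, hts, hts'] at h; exact h
    have hs'u : s' u = false := by
      -- if `u` were red in `t′`, condition 1 at `z` would make `z` red in `t`, i.e. `u` blue in `t`: an atom cannot turn blue → red
      cases hq : s' u with
      | false => rfl
      | true =>
        have hn := h1 none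
        simp only [HN, htn, htn', and_true] at hn
        have hz : (!(s u)) = true := hn hq
        have hsu : s u = false := by
          cases h' : s u with
          | false => rfl
          | true => rw [h'] at hz; exact absurd hz (by decide)
        have h0 := (L1 u hnu ⟨hq, vac s' true⟩).1
        rw [hsu] at h0; exact absurd h0 (by decide)
    refine ⟨hs'u, ⟨L1, L2, fun e he => ?_⟩, fun e he hse => ?_⟩
    · have h := h3 (some e)
      simp only [HS, live s t true e he, live s' t' false e he, hts, hts'] at h; exact h
    · by_contra hne
      have hs'e : s' e = false := by
        cases h' : s' e with
        | false => rfl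
        | true => exact absurd h' hne
      have h := h3 (some e)
      rw [hts, hts'] at h
      have hh := (h hse hs'e).1
      rw [HS] at hh
      exact nomono true e he hh
  · rintro ⟨hs'u, ⟨h1, h2, h3⟩, hd⟩
    refine ⟨fun o => ?_, fun o => ?_, fun o => ?_⟩
    · cases o with
      | none =>
        simp only [HN, htn, htn', and_true]
        intro ha; rw [hs'u] at ha; exact absurd ha (by decide)
      | some e =>
        by_cases he : dead e
        · rintro ⟨-, hb⟩
          rw [HS] at hb
          have h0 := hb.1 u (hdu e he); rw [hts', hs'u] at h0; exact absurd h0 (by decide)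
        · simp only [HS, live s t true e he, live s' t' true e he, hts, hts']; exact h1 e he
    · cases o with
      | none =>
        simp only [HN, htn, htn', and_true]
        intro _; exact hs'u
      | some e =>
        by_cases he : dead e
        · rintro ⟨-, hb⟩; rw [HS] at hb; exact (nomono false e he hb).elim
        · simp only [HS, live s t false e he, live s' t' false e he, hts, hts']; exact h2 e he
    · cases o with
      | none =>
        simp only [HN, htn, htn', and_self]
        intro _ _; trivial
      | some e =>
        by_cases he : dead e
        · intro ha hb
          rw [hts] at ha; rw [hts'] at hb
          have h0 := hd e he ha; rw [h0] at hb; exact absurd hb (by decide)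
        · simp only [HS, live s t true e he, live s' t' false e he, hts, hts']; exact h3 e he

/-- **TRANSFER BOUND.**  For arbitrary finite sets, `⟨1_V − 1_{V′}, 1_X − 1_{X′}⟩ ≥ −#((V ∖ V′) ∩ (X′ ∖ X)) − #((V′ ∖ V) ∩ (X ∖ X′))`, written additively.
(With `X = j″W`, `X′ = j″W′` this bounds the transfer term of the twin decomposition by the antipodal overlap of the two 'rooms'.) [this work] -/
theorem transfer_bound {U : Type*} [DecidableEq U] (V V' X X' : Finset U) :
    (V ∩ X').card + (V' ∩ X).card ≤
      (V ∩ X).card + (V' ∩ X').card + ((V \ V') ∩ (X' \ X)).card + ((V' \ V) ∩ (X \ X')).card := by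
  have h1 : (V ∩ X').card ≤ ((V ∩ X) ∩ X').card + ((V \ V') ∩ (X' \ X)).card + ((V' ∩ X') \ X).card := by
    have hsub : V ∩ X' ⊆ ((V ∩ X) ∩ X') ∪ ((V \ V') ∩ (X' \ X)) ∪ ((V' ∩ X') \ X) := by
      intro x hx
      simp only [Finset.mem_inter] at hx
      simp only [Finset.mem_union, Finset.mem_inter, Finset.mem_sdiff]
      by_cases hX : x ∈ X
      · exact Or.inl (Or.inl ⟨⟨hx.1, hX⟩, hx.2⟩)
      · by_cases hV' : x ∈ V'
        · exact Or.inr ⟨⟨hV', hx.2⟩, hX⟩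
        · exact Or.inl (Or.inr ⟨⟨hx.1, hV'⟩, hx.2, hX⟩)
    calc (V ∩ X').card ≤ (((V ∩ X) ∩ X') ∪ ((V \ V') ∩ (X' \ X)) ∪ ((V' ∩ X') \ X)).card := Finset.card_le_card hsub
      _ ≤ (((V ∩ X) ∩ X') ∪ ((V \ V') ∩ (X' \ X))).card + ((V' ∩ X') \ X).card := Finset.card_union_le _ _
      _ ≤ ((V ∩ X) ∩ X').card + ((V \ V') ∩ (X' \ X)).card + ((V' ∩ X') \ X).card := by
          have h0 := Finset.card_union_le ((V ∩ X) ∩ X') ((V \ V') ∩ (X' \ X)); omega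
  have h2 : (V' ∩ X).card ≤ ((V' ∩ X') ∩ X).card + ((V' \ V) ∩ (X \ X')).card + ((V ∩ X) \ X').card := by
    have hsub : V' ∩ X ⊆ ((V' ∩ X') ∩ X) ∪ ((V' \ V) ∩ (X \ X')) ∪ ((V ∩ X) \ X') := by
      intro x hx
      simp only [Finset.mem_inter] at hx
      simp only [Finset.mem_union, Finset.mem_inter, Finset.mem_sdiff]
      by_cases hX' : x ∈ X'
      · exact Or.inl (Or.inl ⟨⟨hx.1, hX'⟩, hx.2⟩)
      · by_cases hV : x ∈ V
        · exact Or.inr ⟨⟨hV, hx.2⟩, hX'⟩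
        · exact Or.inl (Or.inr ⟨⟨hx.1, hV⟩, hx.2, hX'⟩)
    calc (V' ∩ X).card ≤ (((V' ∩ X') ∩ X) ∪ ((V' \ V) ∩ (X \ X')) ∪ ((V ∩ X) \ X')).card := Finset.card_le_card hsub
      _ ≤ (((V' ∩ X') ∩ X) ∪ ((V' \ V) ∩ (X \ X'))).card + ((V ∩ X) \ X').card := Finset.card_union_le _ _
      _ ≤ ((V' ∩ X') ∩ X).card + ((V' \ V) ∩ (X \ X')).card + ((V ∩ X) \ X').card := by
          have h0 := Finset.card_union_le ((V' ∩ X') ∩ X) ((V' \ V) ∩ (X \ X')); omega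
  have s1 : ((V ∩ X) ∩ X').card + ((V ∩ X) \ X').card = (V ∩ X).card := Finset.card_inter_add_card_sdiff (V ∩ X) X'
  have s2 : ((V' ∩ X') ∩ X).card + ((V' ∩ X') \ X).card = (V' ∩ X').card := Finset.card_inter_add_card_sdiff (V' ∩ X') X
  omega

/-- **TWIN TRANSFER (arithmetic skeleton).**  Let `(A₀, V, V′, A₁)` and `(B₀, W, W′, B₁)` be the fibre traces of two up-sets of the twin bundle `Ω_{Q+z}`
(TWIN STRUCTURE THEOREM: `(A₀,A₁)` an up-set of `Ω_Q`, `V, V′` up-sets of the dead order `M` with `A₀ ⊆ V, V′ ⊆ A₁`), `S.image j` the colour swap.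
If `M` is antipodal Kleitman at `(V,W)` and `(V′,W′)` (`hMV`, `hMV′`) and the twin slack inequality `TSI(Q,u)` holds at this datum in its free form
`AK_{Ω_Q}((A₀,A₁),(B₀,B₁)) + ⟨1_V − 1_{V′}, (1_W − 1_{W′}) ∘ j⟩ ≥ 0` (`hTSI`), then the antipodal-Kleitman inequality of `Ω_{Q+z}` holds at the two up-sets:
`#(A₀∩jB₁) + #(V∩jW′) + #(V′∩jW) + #(A₁∩jB₀) ≤ #(A₀∩B₀) + #(V∩W) + #(V′∩W′) + #(A₁∩B₁)`. [this work] -/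
theorem twin_transfer {U : Type*} [DecidableEq U] (j : U → U) (A₀ A₁ V V' B₀ B₁ W W' : Finset U)
    (hMV : (V ∩ W.image j).card ≤ (V ∩ W).card) (hMV' : (V' ∩ W'.image j).card ≤ (V' ∩ W').card)
    (hTSI : (A₀ ∩ B₁.image j).card + (A₁ ∩ B₀.image j).card + (V ∩ W'.image j).card + (V' ∩ W.image j).card ≤
      (A₀ ∩ B₀).card + (A₁ ∩ B₁).card + (V ∩ W.image j).card + (V' ∩ W'.image j).card) :
    (A₀ ∩ B₁.image j).card + (V ∩ W'.image j).card + (V' ∩ W.image j).card + (A₁ ∩ B₀.image j).card ≤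
      (A₀ ∩ B₀).card + (V ∩ W).card + (V' ∩ W').card + (A₁ ∩ B₁).card := by
  omega

end AntitheticTwinTransfer

end Summit.CriticalPhenomena.PercolationContinuityZ3.Theorems
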